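import Literature.NumberTheory.Rogawski1990.ArchCentralLimitFormulaQuasiSplit     -- ★ p842307 (N3, p02 (g11)): `ArchCentralLimitFormulaRankTwo.clause` (brings the letter ★ p842205 and ★ `locallyCompactSpace_archLocal` ∕ `secondCountableTopology_archLocal`)
import Literature.NumberTheory.Rogawski1990.ArchCompactPlaceCentralLimitFormula    -- ★ p842193∕p842290 (N2 + ED. 2, p03 (g11)): `exists_tendsto_letterLambda_nhdsWithin_of_posDef` (the definite place in the letter's shape)
import Literature.NumberTheory.Automorphic.UnitaryGroupArchUnimodular              -- ★ «ARCH UNIMODULARITY» U2: `UnitaryGroup.modularCharacterFun_archLocal_eq_one`, `isMulRightInvariant_of_modularCharacterFun_eq_one`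
import HarnessLib

/-!
# Assembly kit for the rank-2 central descent (SdArch ED. 3, node N6): the letter's clause AT EVERY FRAME, and right-invariance of Haar measures on `U(σ_w H)(ℂ)`
# (Rogawski 1990 §8.4 pp. 126–127; Knapp 2002 Cor. 8.31)

Topic `NumberTheory/Rogawski1990`; namespaces `Literature.NumberTheory.Automorphic.UnitaryGroup` (§1) and `Literature.NumberTheory.Rogawski1990` (§2).  THEOREMS ONLY (no `def`,
no instance, no notation, no axiom, no named fact, no `sorry`).  Cell `pub/hodgecm-mathlib`, ENGINE T1 (crux H413 = `stmt-HodgeConjecture-24833`); ROAD-Sd residual R4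
(`stub_SdCanonical` of `Cruxes/H413/Lines/F0_P3a_SdArch.lean`), SdArch ED. 3 DESIGN (F0P3a-p03 (g11) census `CENSUS-SdArch-ED3-Design` 7141d221) node **N6 «assembly»**: the two
support lemmas **(S1)** and **(S3)** of F0P3a-p03 (g11)'s N6 ASSEMBLY SUPPORT BRIEF 2026-09-01T08:17:35Z (LEAD F0P3a-plan (g10) WORD T9-3 (4)); (S2) `nhdsWithin_injective_const_neBot` is
F0P3a-p06 (g11)'s ★ `ArchCentralLimitRegularFilter`.  Typed by F0P3a-p02 (g12), 2026-09-01.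

WHAT IS PROVED.
* §1 **(S3) `UnitaryGroup.isMulRightInvariant_of_isHaarMeasure_archLocal`** — every Haar measure on the local archimedean factor `archLocal L N H w = U(σ_w H)(ℂ)` of a `c`-hermitian
  non-degenerate `H` is RIGHT-invariant (`Δ ≡ 1`, ★ `modularCharacterFun_archLocal_eq_one`, read through the unimodularity criterion ★ `isMulRightInvariant_of_modularCharacterFun_eq_one`);
  diagonal dress `…_archLocal_diagonal` (`H = diag α`, `α_i ≠ 0` `c`-fixed) and the frame dress `…_archLocal_diagonal_of_im_eq_zero` (`c`-fixedness READ OFF the frame guard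
  `im σ_w α_i = 0` at one place: `σ_w ∘ c = conj ∘ σ_w`, ★ `embedding_cmConjRingHom`).  So the letter's `[ν.IsMulRightInvariant]` binder is idle bookkeeping for Haar `ν`.
* §2 **(S1) THE LETTER'S CLAUSE AT EVERY FRAME.**  `posDef_or_neg_posDef_diagonal_map_embedding_of_not_exists` — if NO pair `i, j` has `re σ_wα_i · re σ_wα_j < 0` then all `re σ_wα_i`
  (non-zero by the frame guards, ★ `re_embedding_ne_zero`) have ONE sign, i.e. `σ_w diag α` or `−σ_w diag α` is positive definite (the place is DEFINITE);
  **`ArchCentralLimitFormulaRankTwo.exists_pos_of_frame`** — given the (L_{U(2,1)}) letter `h : ArchCentralLimitFormulaRankTwo L α w` (★ p842205, node N1 = the registered stub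
  `stub_ArchCentralLimitU21` of ED. 3) at a frame `(α, w)` with ONLY the frame guards `α_i ≠ 0`, `im σ_wα_i = 0`, EVERY Haar right-invariant `ν` on `G_w = U(σ_w diag α)(ℂ)` has a constant
  `c > 0` with the 8-ray central limit `Λ₈[ρ′Δ·Φ_Θ] → −(c·i)·Θ(ζ•1)` (the letter's body after `∃ c : ℝ, 0 < c ∧`, VERBATIM = the `hL` binder of ★ N5 `tendsto_lambda8_sum_perm_integral_integral_insert`):
  `by_cases` on the indefinite-signature witness — present ⇒ the letter's own clause ★ `ArchCentralLimitFormulaRankTwo.clause`; absent ⇒ the place is definite and the in-house (L_{U(3)})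
  theorem ★ `exists_tendsto_letterLambda_nhdsWithin_of_posDef` gives the clause with `c = 12·ν(K)` (same ray `−i·ℝ_{>0}`, (β-min)).  **`exists_pos_letter_of_frame`** is the same over
  the CLOSED letter `hL21 : ∀ L α w, ArchCentralLimitFormulaRankTwo L α w` (N1's registered text, consumed BY NAME), and `exists_pos_letter_of_frame_of_isHaarMeasure` drops the
  right-invariance binder by §1 — the form F0P3a-p03 (g11)'s `sdDiagonal_of_letter` calls once per place `w` on both sides of (S-d).
HONEST LABEL: HC_CM is proved only modulo the printed citations until rung 0 closes; §2 is CONDITIONAL on the letter hypothesis (node N1), which it consumes by name and does not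
prove; nothing here pays a citation by itself.

## References
* [Rogawski1990] J. D. Rogawski, *Automorphic Representations of Unitary Groups in Three Variables*, Ann. of Math. Stud. 123 (1990), §8.4 pp. 126–127 (the central limit formula,
  `c_G`, `c_{G′} = 3c_G`), §14.2 (14.2.1) p. 232, §14.5 p. 239.
* [Knapp2002] A. W. Knapp, *Lie Groups Beyond an Introduction*, 2nd ed. (2002), VIII.§2 Cor. 8.31 (reductive groups are unimodular).
* [Folland1995] G. B. Folland, *A Course in Abstract Harmonic Analysis* (1995), §2.4 Prop. 2.27.
-/

set_option autoImplicit false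

noncomputable section

open MeasureTheory Measure Filter Topology NumberField NumberField.InfinitePlace
open scoped Matrix MatrixGroups Matrix.Norms.Operator ComplexOrder

/-! ## §1 (S3) Haar measures on `U(σ_w H)(ℂ)` are right-invariant -/

namespace Literature.NumberTheory.Automorphic.UnitaryGroup

section RightInvariant

variable (L : Type) [Field L] [NumberField L] [IsCMField L] {N : ℕ}

/-- **(S3) Every Haar measure on `U(σ_w H)(ℂ) = archLocal L N H w` is right-invariant** (`H` `c`-hermitian non-degenerate): the group is unimodular (★ `modularCharacterFun_archLocal_eq_one`,
reductive real groups), and `map (· * g) ν = Δ(g) • ν` (★ `isMulRightInvariant_of_modularCharacterFun_eq_one`).  The `[ν.IsMulRightInvariant]` binder of the (L_{U(2,1)}) letter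
★ `ArchCentralLimitFormulaRankTwo` is thereby idle for Haar `ν`. [cite: Knapp2002, VIII.§2 Cor. 8.31] [cite: Folland1995, §2.4 Prop. 2.27] -/
theorem isMulRightInvariant_of_isHaarMeasure_archLocal (H : Matrix (Fin N) (Fin N) L) (hherm : (H.map (cmConjRingHom L))ᵀ = H) (hdet : H.det ≠ 0)
    (w : {w : InfinitePlace L // IsComplex w}) [MeasurableSpace (archLocal L N H w)] [BorelSpace (archLocal L N H w)]
    (ν : Measure (archLocal L N H w)) [ν.IsHaarMeasure] : ν.IsMulRightInvariant :=
  haveI := locallyCompactSpace_archLocal L N H w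
  haveI := secondCountableTopology_archLocal L N H w
  isMulRightInvariant_of_modularCharacterFun_eq_one (modularCharacterFun_archLocal_eq_one L H hherm hdet w) ν

/-- **(S3), diagonal dress**: every Haar measure on `U(σ_w diag α)(ℂ)` is right-invariant, for `α_i ≠ 0` fixed by `c` (`diag α` is then `c`-hermitian non-degenerate).
[cite: Knapp2002, VIII.§2 Cor. 8.31] -/
theorem isMulRightInvariant_of_isHaarMeasure_archLocal_diagonal (α : Fin N → L) (hα : ∀ i, α i ≠ 0) (hherm : ∀ i, (IsCMField.complexConj L (α i) : L) = α i)
    (w : {w : InfinitePlace L // IsComplex w}) [MeasurableSpace (archLocal L N (Matrix.diagonal α) w)] [BorelSpace (archLocal L N (Matrix.diagonal α) w)]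
    (ν : Measure (archLocal L N (Matrix.diagonal α) w)) [ν.IsHaarMeasure] : ν.IsMulRightInvariant := by
  refine isMulRightInvariant_of_isHaarMeasure_archLocal L (Matrix.diagonal α) ?_ ?_ w ν
  · rw [Matrix.diagonal_map (map_zero _), Matrix.diagonal_transpose]
    congr 1
    funext i
    exact hherm i
  · rw [Matrix.det_diagonal]
    exact Finset.prod_ne_zero_iff.mpr fun i _ => hα i

/-- **`c`-fixedness read off one place**: if `σ_w α` is real at SOME complex place `w` then `c α = α` (`σ_w (c α) = conj (σ_w α) = σ_w α`, ★ `embedding_cmConjRingHom`, and `σ_w` is injective) —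
the frame guard `im σ_w α_i = 0` of the letter already makes `diag α` `c`-hermitian. [cite: Rogawski1990, §4.9 p. 54] -/
theorem complexConj_eq_self_of_im_embedding_eq_zero (w : {w : InfinitePlace L // IsComplex w}) {x : L} (hx : (w.1.embedding x).im = 0) :
    (IsCMField.complexConj L x : L) = x := by
  have h : w.1.embedding (cmConjRingHom L x) = w.1.embedding x := by
    rw [embedding_cmConjRingHom]
    exact Complex.conj_eq_iff_im.mpr hx
  exact w.1.embedding.injective h

/-- **(S3), frame dress**: every Haar measure on `U(σ_w diag α)(ℂ)` is right-invariant under the letter's frame guards `α_i ≠ 0`, `im σ_w α_i = 0` alone.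
[cite: Knapp2002, VIII.§2 Cor. 8.31] [cite: Rogawski1990, §4.9 p. 54] -/
theorem isMulRightInvariant_of_isHaarMeasure_archLocal_diagonal_of_im_eq_zero (α : Fin N → L) (hα : ∀ i, α i ≠ 0)
    (w : {w : InfinitePlace L // IsComplex w}) (hreal : ∀ i, (w.1.embedding (α i)).im = 0)
    [MeasurableSpace (archLocal L N (Matrix.diagonal α) w)] [BorelSpace (archLocal L N (Matrix.diagonal α) w)]
    (ν : Measure (archLocal L N (Matrix.diagonal α) w)) [ν.IsHaarMeasure] : ν.IsMulRightInvariant :=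
  isMulRightInvariant_of_isHaarMeasure_archLocal_diagonal L α hα (fun i => complexConj_eq_self_of_im_embedding_eq_zero L w (hreal i)) w ν

end RightInvariant

end Literature.NumberTheory.Automorphic.UnitaryGroup

/-! ## §2 (S1) The letter's clause at every frame: indefinite places by the letter, definite places by (L_{U(3)}) -/

namespace Literature.NumberTheory.Rogawski1990

open Literature.NumberTheory.Automorphic Literature.NumberTheory.Automorphic.UnitaryGroup

section Frame

variable {L : Type} [Field L] {α : Fin 3 → L} {w : {w : InfinitePlace L // IsComplex w}}

/-- **A frame with no indefinite pair is DEFINITE**: if `α_i ≠ 0`, `σ_w α_i` real for all `i` (so `re σ_w α_i ≠ 0`, ★ `re_embedding_ne_zero`) and NO `i, j` have `re σ_wα_i · re σ_wα_j < 0`, then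
all `re σ_w α_i` share the sign of `re σ_w α_0`: `σ_w diag α = diag(σ_w α)` is positive definite or `−σ_w diag α` is (`Matrix.posDef_diagonal_iff` under `ComplexOrder`).
[cite: Rogawski1990, §14.2 p. 232] -/
theorem posDef_or_neg_posDef_diagonal_map_embedding_of_not_exists (hα : ∀ i, α i ≠ 0) (hreal : ∀ i, (w.1.embedding (α i)).im = 0)
    (hind : ¬ ∃ i j : Fin 3, (w.1.embedding (α i)).re * (w.1.embedding (α j)).re < 0) :
    ((Matrix.diagonal α).map (w.1.embedding : L →+* ℂ)).PosDef ∨ (-((Matrix.diagonal α).map (w.1.embedding : L →+* ℂ))).PosDef := by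
  have hre : ∀ i, (w.1.embedding (α i)).re ≠ 0 := fun i h0 =>
    (_root_.map_ne_zero (w.1.embedding : L →+* ℂ)).mpr (hα i) (Complex.ext h0 (hreal i))
  push Not at hind
  have hmap : (Matrix.diagonal α).map (w.1.embedding : L →+* ℂ) = Matrix.diagonal fun i => w.1.embedding (α i) :=
    Matrix.diagonal_map (map_zero _)
  have hpos_of : ∀ x : ℂ, 0 < x.re → x.im = 0 → 0 < x := fun x h1 h2 =>
    Complex.lt_def.mpr ⟨by simpa using h1, by simpa using h2.symm⟩
  rcases lt_or_gt_of_ne (hre 0) with h0 | h0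
  · -- `re σ_w α_0 < 0`: every `re σ_w α_i < 0`, so `−σ_w diag α` is positive definite
    right
    rw [hmap, Matrix.diagonal_neg, Matrix.posDef_diagonal_iff]
    intro i
    have hi : (w.1.embedding (α i)).re < 0 := by
      rcases lt_or_gt_of_ne (hre i) with hi | hi
      · exact hi
      · exact absurd (hind 0 i) (not_le.mpr (mul_neg_of_neg_of_pos h0 hi))
    exact hpos_of _ (by simpa using hi) (by simpa using hreal i)
  · -- `0 < re σ_w α_0`: every `0 < re σ_w α_i`, so `σ_w diag α` is positive definite
    left
    rw [hmap, Matrix.posDef_diagonal_iff]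
    intro i
    have hi : 0 < (w.1.embedding (α i)).re := by
      rcases lt_or_gt_of_ne (hre i) with hi | hi
      · exact absurd (hind 0 i) (not_le.mpr (mul_neg_of_pos_of_neg h0 hi))
      · exact hi
    exact hpos_of _ hi (hreal i)

/-- **(S1) THE LETTER'S CLAUSE AT EVERY FRAME** — given the (L_{U(2,1)}) letter `h : ArchCentralLimitFormulaRankTwo L α w` (node N1) at the frame `(α, w)` and ONLY the frame guards
`α_i ≠ 0`, `im σ_w α_i = 0`: for every Haar right-invariant `ν` on `G_w = U(σ_w diag α)(ℂ)` there is `c > 0` with `Λ₈[ρ′Δ·Φ_Θ](z) → −(c·i)·Θ(diag(ζ,ζ,ζ))` as `z → ζ•1` through regular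
torus points, for all ambient smooth `Θ` compactly supported on `G_w` and all central `ζ` (the letter's body after `∃ c : ℝ, 0 < c ∧`, verbatim = the `hL` binder of ★ N5).  INDEFINITE place
(some `re σ_wα_i · re σ_wα_j < 0`, `G_w ≅ U(2,1)`): the letter's clause ★ `ArchCentralLimitFormulaRankTwo.clause`; DEFINITE place (★ `posDef_or_neg_posDef_diagonal_map_embedding_of_not_exists`,
`G_w ≅ U(3)` compact): the in-house (L_{U(3)}) ★ `exists_tendsto_letterLambda_nhdsWithin_of_posDef`, `c = 12·ν(G_w)`, on the same ray `−i·ℝ_{>0}` ((β-min)).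
[cite: Rogawski1990, §8.4 pp. 126–127; §14.5 p. 239] -/
theorem ArchCentralLimitFormulaRankTwo.exists_pos_of_frame
    [MeasurableSpace (archLocal L 3 (Matrix.diagonal α) w)] [BorelSpace (archLocal L 3 (Matrix.diagonal α) w)]
    (h : ArchCentralLimitFormulaRankTwo L α w) (hα : ∀ i, α i ≠ 0) (hreal : ∀ i, (w.1.embedding (α i)).im = 0)
    (ν : Measure (archLocal L 3 (Matrix.diagonal α) w)) [ν.IsHaarMeasure] [ν.IsMulRightInvariant] :
    ∃ c : ℝ, 0 < c ∧
      ∀ (Θ : Matrix (Fin 3) (Fin 3) ℂ → ℂ), ContDiff ℝ (⊤ : ℕ∞) Θ →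
        HasCompactSupport (fun k : archLocal L 3 (Matrix.diagonal α) w => Θ ((k : GL (Fin 3) ℂ) : Matrix (Fin 3) (Fin 3) ℂ)) →
        ∀ ζ : Circle,
          Tendsto (fun z : Fin 3 → Circle =>
              (1 / 48 : ℂ) * ∑ ε : Fin 3 → Bool, ((((if ε 0 then (1 : ℝ) else -1) * (if ε 1 then (1 : ℝ) else -1) * (if ε 2 then (1 : ℝ) else -1) : ℝ)) : ℂ) *
                iteratedDeriv 3 (fun s : ℝ => ((((z 0 * Circle.exp (s * (![(if ε 0 then (1 : ℝ) else -1) + (if ε 1 then (1 : ℝ) else -1), -(if ε 0 then (1 : ℝ) else -1) + (if ε 2 then (1 : ℝ) else -1), -(if ε 1 then (1 : ℝ) else -1) - (if ε 2 then (1 : ℝ) else -1)] 0)) : Circle) : ℂ)) * (((z 2 * Circle.exp (s * (![(if ε 0 then (1 : ℝ) else -1) + (if ε 1 then (1 : ℝ) else -1), -(if ε 0 then (1 : ℝ) else -1) + (if ε 2 then (1 : ℝ) else -1), -(if ε 1 then (1 : ℝ) else -1) - (if ε 2 then (1 : ℝ) else -1)] 2)) : Circle) : ℂ))⁻¹) *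 ((1 - (((z 1 * Circle.exp (s * (![(if ε 0 then (1 : ℝ) else -1) + (if ε 1 then (1 : ℝ) else -1), -(if ε 0 then (1 : ℝ) else -1) + (if ε 2 then (1 : ℝ) else -1), -(if ε 1 then (1 : ℝ) else -1) - (if ε 2 then (1 : ℝ) else -1)] 1)) : Circle) : ℂ)) * (((z 0 * Circle.exp (s * (![(if ε 0 then (1 : ℝ) else -1) + (if ε 1 then (1 : ℝ) else -1), -(if ε 0 then (1 : ℝ) else -1) + (if ε 2 then (1 : ℝ) else -1), -(if ε 1 then (1 : ℝ) else -1) - (if ε 2 then (1 : ℝ) else -1)] 0)) : Circle) : ℂ))⁻¹) * (1 - (((z 2 * Circle.exp (s * (![(if ε 0 then (1 : ℝ) else -1) + (if ε 1 then (1 : ℝ) else -1), -(if ε 0 then (1 : ℝ) else -1) + (if ε 2 then (1 : ℝ) else -1), -(if ε 1 then (1 : ℝ) else -1) - (if ε 2 then (1 : ℝ) else -1)] 2)) : Circle) : ℂ)) * (((z 1 * Circle.exp (s * (![(if ε 0 then (1 : ℝ) else -1) + (if ε 1 then (1 : ℝ) else -1), -(if ε 0 then (1 : ℝ) else -1) +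 (if ε 2 then (1 : ℝ) else -1), -(if ε 1 then (1 : ℝ) else -1) - (if ε 2 then (1 : ℝ) else -1)] 1)) : Circle) : ℂ))⁻¹) * (1 - (((z 2 * Circle.exp (s * (![(if ε 0 then (1 : ℝ) else -1) + (if ε 1 then (1 : ℝ) else -1), -(if ε 0 then (1 : ℝ) else -1) + (if ε 2 then (1 : ℝ) else -1), -(if ε 1 then (1 : ℝ) else -1) - (if ε 2 then (1 : ℝ) else -1)] 2)) : Circle) : ℂ)) * (((z 0 * Circle.exp (s * (![(if ε 0 then (1 : ℝ) else -1) + (if ε 1 then (1 : ℝ) else -1), -(if ε 0 then (1 : ℝ) else -1) + (if ε 2 then (1 : ℝ) else -1), -(if ε 1 then (1 : ℝ) else -1) - (if ε 2 then (1 : ℝ) else -1)] 0)) : Circle) : ℂ))⁻¹)) * (∫ g, Θ (((g * ⟨circleDiagonal 3 (fun k => z k * Circle.exp (s * (![(if ε 0 then (1 : ℝ) else -1) + (if ε 1 then (1 : ℝ) else -1), -(if ε 0 then (1 : ℝ) else -1) + (if ε 2 then (1 : ℝ) else -1), -(if ε 1 then (1 : ℝ) else -1) - (if ε 2 then (1 :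 ℝ) else -1)] k))), circleDiagonal_mem_archLocal_diagonal L 3 α w _⟩ * g⁻¹ : archLocal L 3 (Matrix.diagonal α) w) : GL (Fin 3) ℂ) : Matrix (Fin 3) (Fin 3) ℂ) ∂ν)) 0)
            (𝓝[{z : Fin 3 → Circle | Function.Injective z}] (fun _ => ζ))
            (𝓝 (-((c : ℂ) * Complex.I) * Θ ((circleDiagonal 3 (fun _ => ζ) : GL (Fin 3) ℂ) : Matrix (Fin 3) (Fin 3) ℂ))) := by
  by_cases hind : ∃ i j : Fin 3, (w.1.embedding (α i)).re * (w.1.embedding (α j)).re < 0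
  · exact h.clause hα hreal hind ν
  · exact exists_tendsto_letterLambda_nhdsWithin_of_posDef L α w (posDef_or_neg_posDef_diagonal_map_embedding_of_not_exists hα hreal hind) ν

end Frame

section Letter

/-- **(S1) OVER THE CLOSED LETTER, BY NAME** — the form F0P3a-p03 (g11)'s N6 assembly `sdDiagonal_of_letter` calls once per place on both sides of (S-d): from
`hL21 : ∀ L α w, ArchCentralLimitFormulaRankTwo L α w` (= the registered stub `stub_ArchCentralLimitU21` of SdArch ED. 3, consumed BY NAME), a frame `(L, α, w)` with guards `α_i ≠ 0`,
`im σ_w α_i = 0`, and a Haar right-invariant `ν` on `G_w`, the clause `∃ c > 0, ∀ Θ …` at EVERY place — indefinite or definite (★ `ArchCentralLimitFormulaRankTwo.exists_pos_of_frame`).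
[cite: Rogawski1990, §8.4 pp. 126–127; §14.5 p. 239] -/
theorem exists_pos_letter_of_frame
    (hL21 : ∀ (L : Type) [Field L] (α : Fin 3 → L) (w : {w : InfinitePlace L // IsComplex w}), ArchCentralLimitFormulaRankTwo L α w)
    (L : Type) [Field L] (α : Fin 3 → L) (w : {w : InfinitePlace L // IsComplex w}) (hα : ∀ i, α i ≠ 0) (hreal : ∀ i, (w.1.embedding (α i)).im = 0)
    [MeasurableSpace (archLocal L 3 (Matrix.diagonal α) w)] [BorelSpace (archLocal L 3 (Matrix.diagonal α) w)]
    (ν : Measure (archLocal L 3 (Matrix.diagonal α) w)) [ν.IsHaarMeasure] [ν.IsMulRightInvariant] :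
    ∃ c : ℝ, 0 < c ∧
      ∀ (Θ : Matrix (Fin 3) (Fin 3) ℂ → ℂ), ContDiff ℝ (⊤ : ℕ∞) Θ →
        HasCompactSupport (fun k : archLocal L 3 (Matrix.diagonal α) w => Θ ((k : GL (Fin 3) ℂ) : Matrix (Fin 3) (Fin 3) ℂ)) →
        ∀ ζ : Circle,
          Tendsto (fun z : Fin 3 → Circle =>
              (1 / 48 : ℂ) * ∑ ε : Fin 3 → Bool, ((((if ε 0 then (1 : ℝ) else -1) * (if ε 1 then (1 : ℝ) else -1) * (if ε 2 then (1 : ℝ) else -1) : ℝ)) : ℂ) *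
                iteratedDeriv 3 (fun s : ℝ => ((((z 0 * Circle.exp (s * (![(if ε 0 then (1 : ℝ) else -1) + (if ε 1 then (1 : ℝ) else -1), -(if ε 0 then (1 : ℝ) else -1) + (if ε 2 then (1 : ℝ) else -1), -(if ε 1 then (1 : ℝ) else -1) - (if ε 2 then (1 : ℝ) else -1)] 0)) : Circle) : ℂ)) * (((z 2 * Circle.exp (s * (![(if ε 0 then (1 : ℝ) else -1) + (if ε 1 then (1 : ℝ) else -1), -(if ε 0 then (1 : ℝ) else -1) + (if ε 2 then (1 : ℝ) else -1), -(if ε 1 then (1 : ℝ) else -1) - (if ε 2 then (1 : ℝ) else -1)] 2)) : Circle) : ℂ))⁻¹) * ((1 - (((z 1 * Circle.exp (s * (![(if ε 0 then (1 : ℝ) else -1) + (if ε 1 then (1 : ℝ) else -1), -(if ε 0 then (1 : ℝ) else -1) + (if ε 2 then (1 : ℝ) else -1), -(if ε 1 then (1 : ℝ) else -1) - (if ε 2 then (1 : ℝ) else -1)] 1)) : Circle) : ℂ)) * (((z 0 * Circle.exp (s * (![(if ε 0 then (1 : ℝ) else -1) + (if ε 1 then (1 : ℝ) else -1), -(if ε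 0 then (1 : ℝ) else -1) + (if ε 2 then (1 : ℝ) else -1), -(if ε 1 then (1 : ℝ) else -1) - (if ε 2 then (1 : ℝ) else -1)] 0)) : Circle) : ℂ))⁻¹) * (1 - (((z 2 * Circle.exp (s * (![(if ε 0 then (1 : ℝ) else -1) + (if ε 1 then (1 : ℝ) else -1), -(if ε 0 then (1 : ℝ) else -1) + (if ε 2 then (1 : ℝ) else -1), -(if ε 1 then (1 : ℝ) else -1) - (if ε 2 then (1 : ℝ) else -1)] 2)) : Circle) : ℂ)) * (((z 1 * Circle.exp (s * (![(if ε 0 then (1 : ℝ) else -1) + (if ε 1 then (1 : ℝ) else -1), -(if ε 0 then (1 : ℝ) else -1) + (if ε 2 then (1 : ℝ) else -1), -(if ε 1 then (1 : ℝ) else -1) - (if ε 2 then (1 : ℝ) else -1)] 1)) : Circle) : ℂ))⁻¹) * (1 - (((z 2 * Circle.exp (s * (![(if ε 0 then (1 : ℝ) else -1) + (if ε 1 then (1 : ℝ) else -1), -(if ε 0 then (1 : ℝ) else -1) + (if ε 2 then (1 : ℝ) else -1), -(if ε 1 then (1 : ℝ) else -1) - (if ε 2 then (1 : ℝ) else -1)]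 2)) : Circle) : ℂ)) * (((z 0 * Circle.exp (s * (![(if ε 0 then (1 : ℝ) else -1) + (if ε 1 then (1 : ℝ) else -1), -(if ε 0 then (1 : ℝ) else -1) + (if ε 2 then (1 : ℝ) else -1), -(if ε 1 then (1 : ℝ) else -1) - (if ε 2 then (1 : ℝ) else -1)] 0)) : Circle) : ℂ))⁻¹)) * (∫ g, Θ (((g * ⟨circleDiagonal 3 (fun k => z k * Circle.exp (s * (![(if ε 0 then (1 : ℝ) else -1) + (if ε 1 then (1 : ℝ) else -1), -(if ε 0 then (1 : ℝ) else -1) + (if ε 2 then (1 : ℝ) else -1), -(if ε 1 then (1 : ℝ) else -1) - (if ε 2 then (1 : ℝ) else -1)] k))), circleDiagonal_mem_archLocal_diagonal L 3 α w _⟩ * g⁻¹ : archLocal L 3 (Matrix.diagonal α) w) : GL (Fin 3) ℂ) : Matrix (Fin 3) (Fin 3) ℂ) ∂ν)) 0)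
            (𝓝[{z : Fin 3 → Circle | Function.Injective z}] (fun _ => ζ))
            (𝓝 (-((c : ℂ) * Complex.I) * Θ ((circleDiagonal 3 (fun _ => ζ) : GL (Fin 3) ℂ) : Matrix (Fin 3) (Fin 3) ℂ))) :=
  ArchCentralLimitFormulaRankTwo.exists_pos_of_frame (@hL21 L _ α w) hα hreal ν

/-- **(S1) FOR A BARE HAAR MEASURE** (the right-invariance binder discharged by §1 ★ `isMulRightInvariant_of_isHaarMeasure_archLocal_diagonal_of_im_eq_zero`; `L` a CM field): from the closed
letter `hL21`, the frame guards and ANY Haar `ν` on `G_w = U(σ_w diag α)(ℂ)`, the clause `∃ c > 0, ∀ Θ …` — the per-place input `(c_w, c′_w)` of the (D2) choice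
`ν := κ′·(∏_w c′_w ∕ c_w) • …` of the ED. 3 design. [cite: Rogawski1990, §8.4 pp. 126–127; §14.5 p. 239] [cite: Knapp2002, VIII.§2 Cor. 8.31] -/
theorem exists_pos_letter_of_frame_of_isHaarMeasure
    (hL21 : ∀ (L : Type) [Field L] (α : Fin 3 → L) (w : {w : InfinitePlace L // IsComplex w}), ArchCentralLimitFormulaRankTwo L α w)
    (L : Type) [Field L] [NumberField L] [IsCMField L] (α : Fin 3 → L) (w : {w : InfinitePlace L // IsComplex w}) (hα : ∀ i, α i ≠ 0)
    (hreal : ∀ i, (w.1.embedding (α i)).im = 0)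
    [MeasurableSpace (archLocal L 3 (Matrix.diagonal α) w)] [BorelSpace (archLocal L 3 (Matrix.diagonal α) w)]
    (ν : Measure (archLocal L 3 (Matrix.diagonal α) w)) [ν.IsHaarMeasure] :
    ∃ c : ℝ, 0 < c ∧
      ∀ (Θ : Matrix (Fin 3) (Fin 3) ℂ → ℂ), ContDiff ℝ (⊤ : ℕ∞) Θ →
        HasCompactSupport (fun k : archLocal L 3 (Matrix.diagonal α) w => Θ ((k : GL (Fin 3) ℂ) : Matrix (Fin 3) (Fin 3) ℂ)) →
        ∀ ζ : Circle,
          Tendsto (fun z : Fin 3 → Circle =>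
              (1 / 48 : ℂ) * ∑ ε : Fin 3 → Bool, ((((if ε 0 then (1 : ℝ) else -1) * (if ε 1 then (1 : ℝ) else -1) * (if ε 2 then (1 : ℝ) else -1) : ℝ)) : ℂ) *
                iteratedDeriv 3 (fun s : ℝ => ((((z 0 * Circle.exp (s * (![(if ε 0 then (1 : ℝ) else -1) + (if ε 1 then (1 : ℝ) else -1), -(if ε 0 then (1 : ℝ) else -1) + (if ε 2 then (1 : ℝ) else -1), -(if ε 1 then (1 : ℝ) else -1) - (if ε 2 then (1 : ℝ) else -1)] 0)) : Circle) : ℂ)) * (((z 2 * Circle.exp (s * (![(if ε 0 then (1 : ℝ) else -1) + (if ε 1 then (1 : ℝ) else -1), -(if ε 0 then (1 : ℝ) else -1) + (if ε 2 then (1 : ℝ) else -1), -(if ε 1 then (1 : ℝ) else -1) - (if ε 2 then (1 : ℝ) else -1)] 2)) : Circle) : ℂ))⁻¹) * ((1 - (((z 1 * Circle.exp (s * (![(if ε 0 then (1 : ℝ) else -1) + (if ε 1 then (1 : ℝ) else -1), -(if ε 0 then (1 : ℝ) else -1) + (if ε 2 then (1 : ℝ) else -1), -(if ε 1 then (1 :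 ℝ) else -1) - (if ε 2 then (1 : ℝ) else -1)] 1)) : Circle) : ℂ)) * (((z 0 * Circle.exp (s * (![(if ε 0 then (1 : ℝ) else -1) + (if ε 1 then (1 : ℝ) else -1), -(if ε 0 then (1 : ℝ) else -1) + (if ε 2 then (1 : ℝ) else -1), -(if ε 1 then (1 : ℝ) else -1) - (if ε 2 then (1 : ℝ) else -1)] 0)) : Circle) : ℂ))⁻¹) * (1 - (((z 2 * Circle.exp (s * (![(if ε 0 then (1 : ℝ) else -1) + (if ε 1 then (1 : ℝ) else -1), -(if ε 0 then (1 : ℝ) else -1) + (if ε 2 then (1 : ℝ) else -1), -(if ε 1 then (1 : ℝ) else -1) - (if ε 2 then (1 : ℝ) else -1)] 2)) : Circle) : ℂ)) * (((z 1 * Circle.exp (s * (![(if ε 0 then (1 : ℝ) else -1) + (if ε 1 then (1 : ℝ) else -1), -(if ε 0 then (1 : ℝ) else -1) + (if ε 2 then (1 : ℝ) else -1), -(if ε 1 then (1 : ℝ) else -1) - (if ε 2 then (1 : ℝ) else -1)] 1)) : Circle) : ℂ))⁻¹) * (1 - (((z 2 * Circle.exp (s * (![(if ε 0 then (1 : ℝ)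 else -1) + (if ε 1 then (1 : ℝ) else -1), -(if ε 0 then (1 : ℝ) else -1) + (if ε 2 then (1 : ℝ) else -1), -(if ε 1 then (1 : ℝ) else -1) - (if ε 2 then (1 : ℝ) else -1)] 2)) : Circle) : ℂ)) * (((z 0 * Circle.exp (s * (![(if ε 0 then (1 : ℝ) else -1) + (if ε 1 then (1 : ℝ) else -1), -(if ε 0 then (1 : ℝ) else -1) + (if ε 2 then (1 : ℝ) else -1), -(if ε 1 then (1 : ℝ) else -1) - (if ε 2 then (1 : ℝ) else -1)] 0)) : Circle) : ℂ))⁻¹)) * (∫ g, Θ (((g * ⟨circleDiagonal 3 (fun k => z k * Circle.exp (s * (![(if ε 0 then (1 : ℝ) else -1) + (if ε 1 then (1 : ℝ) else -1), -(if ε 0 then (1 : ℝ) else -1) + (if ε 2 then (1 : ℝ) else -1), -(if ε 1 then (1 : ℝ) else -1) - (if ε 2 then (1 : ℝ) else -1)] k))), circleDiagonal_mem_archLocal_diagonal L 3 α w _⟩ * g⁻¹ : archLocal L 3 (Matrix.diagonal α) w) : GL (Fin 3) ℂ) : Matrix (Fin 3) (Fin 3) ℂ) ∂ν)) 0)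
            (𝓝[{z : Fin 3 → Circle | Function.Injective z}] (fun _ => ζ))
            (𝓝 (-((c : ℂ) * Complex.I) * Θ ((circleDiagonal 3 (fun _ => ζ) : GL (Fin 3) ℂ) : Matrix (Fin 3) (Fin 3) ℂ))) :=
  haveI := isMulRightInvariant_of_isHaarMeasure_archLocal_diagonal_of_im_eq_zero L α hα w hreal ν
  exists_pos_letter_of_frame hL21 L α w hα hreal ν

end Letter

end Literature.NumberTheory.Rogawski1990

end
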